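import Mathlib
import HarnessLib

/-!
# Ward ⇒ Möbius, part 1: the unit inversion on configuration space — calculus, change of variables

Support file for item stmt-CriticalPhenomena-5357 (`WardToMoebius`, route `PrimaryAtInfinity`,
sub-problem `Ising3DConformalLimit`).

For the unit inversion `ι = EuclideanGeometry.inversion 0 1` (`x ↦ x/‖x‖²`) of a real inner product
space and its coordinatewise extension `ιₙ` to configurations `Fin n → EuclideanSpace ℝ (Fin 3)` we
record: the formula `ι x = (‖x‖²)⁻¹ • x`, `‖ι x‖ = ‖x‖⁻¹`, the Fréchet derivative of `ι` (Mathlib's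
`EuclideanGeometry.hasFDerivAt_inversion`) and the key identity `Dι(y)[‖y‖² a − 2⟪a,y⟫ y] = a`
(the special-conformal vector field is `ι`-related to the constant field, `K = ι P ι`), the
Jacobian `|det Dιₙ(x)| = ∏ᵢ ‖xᵢ‖⁻⁶` on `(ℝ³)ⁿ` (`ContinuousLinearMap.det_pi`,
`Submodule.det_reflection`), and the change of variables `∫ g = ∫ (∏ᵢ ‖xᵢ‖⁻⁶) g(ιₙ x) dx`
(`MeasureTheory.integral_image_eq_integral_abs_det_fderiv_smul` on the conull open set of
configurations avoiding the origin).

References: Di Francesco–Mathieu–Sénéchal, *Conformal Field Theory* (1997) §4.1 (inversion and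
special conformal transformations); the analysis is folklore. No definitions are introduced.
-/

noncomputable section

open MeasureTheory EuclideanGeometry Real Set Function
open scoped RealInnerProductSpace

namespace Summit.CriticalPhenomena.Ising3DConformalLimit.WardToMoebius

/-! ### The unit inversion of a real inner product space -/

section InnerProduct

variable {V : Type*} [NormedAddCommGroup V] [InnerProductSpace ℝ V]

/-- The unit inversion about the origin is `x ↦ (‖x‖²)⁻¹ • x`. [folklore] -/
theorem inversion_zero_one_eq (x : V) : inversion 0 1 x = (‖x‖ ^ 2)⁻¹ • x := by
  simp [inversion_def, dist_zero_right, inv_pow]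

/-- `‖ι x‖ = ‖x‖⁻¹` for the unit inversion about the origin. [folklore] -/
theorem norm_inversion_zero_one (x : V) : ‖inversion 0 1 x‖ = ‖x‖⁻¹ := by
  have h := dist_inversion_center (0 : V) x 1
  simpa using h

/-- The unit inversion of a nonzero vector is nonzero. [folklore] -/
theorem inversion_zero_one_ne_zero {x : V} (hx : x ≠ 0) : inversion 0 1 x ≠ 0 := by
  rwa [Ne, inversion_eq_center one_ne_zero]

/-- The unit inversion is an involution (with Mathlib's convention `ι 0 = 0`). [folklore] -/
theorem inversion_zero_one_inversion (x : V) : inversion 0 1 (inversion 0 1 x) = x :=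
  inversion_inversion 0 one_ne_zero x

/-- Fréchet derivative of the unit inversion at `x ≠ 0`:
`Dι(x) = ‖x‖⁻² · (reflection in the hyperplane x^⊥)` (Mathlib `hasFDerivAt_inversion`).
[folklore] -/
theorem hasFDerivAt_inversion_zero_one {x : V} (hx : x ≠ 0) :
    HasFDerivAt (inversion (0 : V) 1)
      ((1 / ‖x‖) ^ 2 • ((ℝ ∙ x)ᗮ.reflection : V →L[ℝ] V)) x := by
  have h := hasFDerivAt_inversion (c := (0 : V)) (R := (1 : ℝ)) hx
  simpa [dist_zero_right] using h

/-- The derivative of the unit inversion maps the special-conformal vector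
`‖y‖² a − 2⟪a, y⟫ y` at `y ≠ 0` to the constant vector `a`: the special-conformal vector field is
the push-forward of the translation field under `ι` (`K = ι P ι`, Di Francesco–Mathieu–Sénéchal
1997 §4.1). [folklore] -/
theorem fderiv_inversion_sct {y : V} (hy : y ≠ 0) (a : V) :
    ((1 / ‖y‖) ^ 2 • ((ℝ ∙ y)ᗮ.reflection : V →L[ℝ] V)) (‖y‖ ^ 2 • a - (2 * ⟪a, y⟫) • y)
      = a := by
  have hy2 : ‖y‖ ^ 2 ≠ 0 := by positivity
  have hcoe : ∀ v : V, ((ℝ ∙ y)ᗮ.reflection : V →L[ℝ] V) v = (ℝ ∙ y)ᗮ.reflection v :=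
    fun v => rfl
  rw [smul_apply, hcoe, Submodule.reflection_orthogonal_apply,
    Submodule.reflection_singleton_apply]
  have hinner : ⟪y, ‖y‖ ^ 2 • a - (2 * ⟪a, y⟫) • y⟫ = -(‖y‖ ^ 2 * ⟪a, y⟫) := by
    rw [inner_sub_right, inner_smul_right, inner_smul_right, real_inner_self_eq_norm_sq,
      real_inner_comm]
    ring
  rw [hinner]
  simp only [RCLike.ofReal_real_eq_id, id_eq]
  rw [show -(‖y‖ ^ 2 * ⟪a, y⟫) / ‖y‖ ^ 2 = -⟪a, y⟫ by field_simp, ← Nat.cast_smul_eq_nsmul ℝ,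
    Nat.cast_ofNat]
  rw [show -((2 : ℝ) • (-⟪a, y⟫) • y - (‖y‖ ^ 2 • a - (2 * ⟪a, y⟫) • y)) = ‖y‖ ^ 2 • a by
    module]
  rw [smul_smul, show (1 / ‖y‖) ^ 2 * ‖y‖ ^ 2 = 1 by field_simp, one_smul]

end InnerProduct

/-! ### Jacobian of the unit inversion of `ℝ³` -/

/-- Jacobian of the unit inversion of `ℝ³`: `|det Dι(x)| = ‖x‖⁻⁶`. [folklore] -/
theorem abs_det_fderiv_inversion {x : EuclideanSpace ℝ (Fin 3)} (hx : x ≠ 0) :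
    |((1 / ‖x‖) ^ 2 • ((ℝ ∙ x)ᗮ.reflection :
        EuclideanSpace ℝ (Fin 3) →L[ℝ] EuclideanSpace ℝ (Fin 3))).det| = ‖x‖ ^ (-6 : ℝ) := by
  have hxn : 0 < ‖x‖ := norm_pos_iff.2 hx
  set Rf : EuclideanSpace ℝ (Fin 3) →L[ℝ] EuclideanSpace ℝ (Fin 3) := (ℝ ∙ x)ᗮ.reflection
    with hRf
  have h1 : ((1 / ‖x‖) ^ 2 • Rf).det
      = ((1 / ‖x‖) ^ 2) ^ 3 * LinearMap.det (Rf : EuclideanSpace ℝ (Fin 3) →ₗ[ℝ] _) := by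
    rw [ContinuousLinearMap.det, ContinuousLinearMap.toLinearMap_smul, LinearMap.det_smul,
      finrank_euclideanSpace, Fintype.card_fin]
  have h2 : LinearMap.det (Rf : EuclideanSpace ℝ (Fin 3) →ₗ[ℝ] _)
      = (-1) ^ Module.finrank ℝ (↥((ℝ ∙ x)ᗮᗮ)) := by
    rw [← Submodule.det_reflection]
    rfl
  rw [h1, h2, abs_mul, abs_of_pos (by positivity : (0 : ℝ) < ((1 / ‖x‖) ^ 2) ^ 3), abs_pow,
    abs_neg, abs_one, one_pow, mul_one]
  rw [Real.rpow_neg hxn.le, show (6 : ℝ) = ((6 : ℕ) : ℝ) by norm_num, Real.rpow_natCast]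
  field_simp

/-! ### Configurations: the coordinatewise inversion `ιₙ` of `(ℝ³)ⁿ` -/

variable {n : ℕ}

/-- The coordinatewise unit inversion is an involution of configuration space. [folklore] -/
theorem invConfig_invConfig (x : Fin n → EuclideanSpace ℝ (Fin 3)) :
    (fun i => inversion (0 : EuclideanSpace ℝ (Fin 3)) 1
      (inversion (0 : EuclideanSpace ℝ (Fin 3)) 1 (x i))) = x := by
  funext i; exact inversion_zero_one_inversion (x i)

/-- Fréchet derivative of the coordinatewise inversion at a configuration avoiding the origin:
the block-diagonal map with blocks `Dι(xᵢ)`. [folklore] -/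
theorem hasFDerivAt_invConfig {x : Fin n → EuclideanSpace ℝ (Fin 3)} (hx : ∀ i, x i ≠ 0) :
    HasFDerivAt
      (fun (y : Fin n → EuclideanSpace ℝ (Fin 3)) i =>
        inversion (0 : EuclideanSpace ℝ (Fin 3)) 1 (y i))
      (ContinuousLinearMap.pi fun i =>
        ((1 / ‖x i‖) ^ 2 • ((ℝ ∙ x i)ᗮ.reflection :
            EuclideanSpace ℝ (Fin 3) →L[ℝ] EuclideanSpace ℝ (Fin 3))).comp
          (ContinuousLinearMap.proj i)) x :=
  hasFDerivAt_pi.2 fun i => by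
    have h2 : HasFDerivAt (fun (f : Fin n → EuclideanSpace ℝ (Fin 3)) => f i)
        (ContinuousLinearMap.proj (R := ℝ) i) x :=
      hasFDerivAt_apply i x
    exact (hasFDerivAt_inversion_zero_one (hx i)).comp x h2

/-- Jacobian of the coordinatewise inversion: `|det Dιₙ(x)| = ∏ᵢ ‖xᵢ‖⁻⁶`. [folklore] -/
theorem abs_det_fderiv_invConfig {x : Fin n → EuclideanSpace ℝ (Fin 3)} (hx : ∀ i, x i ≠ 0) :
    |(ContinuousLinearMap.pi fun i =>
        ((1 / ‖x i‖) ^ 2 • ((ℝ ∙ x i)ᗮ.reflection :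
            EuclideanSpace ℝ (Fin 3) →L[ℝ] EuclideanSpace ℝ (Fin 3))).comp
          (ContinuousLinearMap.proj i)).det| = ∏ i, ‖x i‖ ^ (-6 : ℝ) := by
  rw [ContinuousLinearMap.det_pi, Finset.abs_prod]
  exact Finset.prod_congr rfl fun i _ => abs_det_fderiv_inversion (hx i)

/-- The configurations avoiding the origin form an open set. [folklore] -/
theorem isOpen_forall_ne_zero :
    IsOpen {x : Fin n → EuclideanSpace ℝ (Fin 3) | ∀ i, x i ≠ 0} := by
  simp only [setOf_forall]
  exact isOpen_iInter_of_finite fun i => isOpen_ne_fun (continuous_apply i) continuous_const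

/-- Almost every configuration avoids the origin (each `{xᵢ = 0}` is a proper subspace, hence
Lebesgue-null). [folklore] -/
theorem ae_forall_ne_zero : ∀ᵐ x : Fin n → EuclideanSpace ℝ (Fin 3), ∀ i, x i ≠ 0 := by
  have h : ∀ i : Fin n, ∀ᵐ x : Fin n → EuclideanSpace ℝ (Fin 3), x i ≠ 0 := by
    intro i
    set K : Submodule ℝ (Fin n → EuclideanSpace ℝ (Fin 3)) :=
      LinearMap.ker (LinearMap.proj (R := ℝ) (φ := fun _ : Fin n => EuclideanSpace ℝ (Fin 3)) i)
      with hK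
    have hker : (volume : Measure (Fin n → EuclideanSpace ℝ (Fin 3))) K = 0 := by
      apply Measure.addHaar_submodule
      intro htop
      have hmem : (Pi.single i (EuclideanSpace.single (0 : Fin 3) (1 : ℝ)) :
          Fin n → EuclideanSpace ℝ (Fin 3)) ∈ K := by
        rw [htop]; exact Submodule.mem_top
      rw [hK, LinearMap.mem_ker, LinearMap.proj_apply, Pi.single_eq_same] at hmem
      have := congrArg (fun v : EuclideanSpace ℝ (Fin 3) => v 0) hmem
      simp at this
    rw [ae_iff]
    refine measure_mono_null (fun x hx => ?_) hker
    simp only [ne_eq, mem_setOf_eq, not_not] at hx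
    simp [hK, hx]
  rw [← ae_all_iff] at h
  exact h

/-- **Change of variables under the coordinatewise unit inversion.** For every `g : (ℝ³)ⁿ → ℝ`,
`∫ g = ∫ (∏ᵢ ‖xᵢ‖⁻⁶) · g(ιₙ x) dx` (Lebesgue measure; both sides are `0` when `g` is not
integrable). Proof: `MeasureTheory.integral_image_eq_integral_abs_det_fderiv_smul` on the conull
open set `{∀ i, xᵢ ≠ 0}`, on which `ιₙ` is an injective self-map with Jacobian `∏ᵢ ‖xᵢ‖⁻⁶`.
[folklore] -/
theorem integral_comp_invConfig (g : (Fin n → EuclideanSpace ℝ (Fin 3)) → ℝ) :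
    ∫ x, g x = ∫ x : Fin n → EuclideanSpace ℝ (Fin 3),
      (∏ i, ‖x i‖ ^ (-6 : ℝ)) * g (fun i => inversion (0 : EuclideanSpace ℝ (Fin 3)) 1 (x i)) := by
  set s : Set (Fin n → EuclideanSpace ℝ (Fin 3)) := {x | ∀ i, x i ≠ 0} with hs_def
  set invC : (Fin n → EuclideanSpace ℝ (Fin 3)) → (Fin n → EuclideanSpace ℝ (Fin 3)) :=
    fun x i => inversion (0 : EuclideanSpace ℝ (Fin 3)) 1 (x i) with hinvC
  have hs_meas : MeasurableSet s := isOpen_forall_ne_zero.measurableSet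
  have h_ae : ∀ᵐ x : Fin n → EuclideanSpace ℝ (Fin 3), x ∈ s := ae_forall_ne_zero
  have hmaps : ∀ x ∈ s, invC x ∈ s := fun x hx i => inversion_zero_one_ne_zero (hx i)
  have hinv : ∀ x, invC (invC x) = x := fun x => invConfig_invConfig x
  have himage : invC '' s = s := by
    apply Subset.antisymm
    · rintro _ ⟨x, hx, rfl⟩; exact hmaps x hx
    · intro x hx
      exact ⟨_, hmaps x hx, hinv x⟩
  have hinj : InjOn invC s := by
    intro x _ y _ hxy
    have := congrArg invC hxy
    simpa only [hinv] using this
  have key := integral_image_eq_integral_abs_det_fderiv_smul volume hs_meas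
    (fun x hx => (hasFDerivAt_invConfig hx).hasFDerivWithinAt) hinj g
  rw [himage, Measure.restrict_eq_self_of_ae_mem h_ae] at key
  rw [key]
  refine integral_congr_ae (h_ae.mono fun x hx => ?_)
  simp only [smul_eq_mul]
  rw [abs_det_fderiv_invConfig hx]

end Summit.CriticalPhenomena.Ising3DConformalLimit.WardToMoebius
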